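import Summits.ValiantsHypothesis.ValiantsHypothesis.Theorems.BinomialElusiveBinomialCandidateJetReductionCoordinates

/-!
# Crux `BinomialElusive.BinomialCandidate` (stmt-ValiantsHypothesis-7392), line `registered` —
# stub `stub_jetReduction` (part 4/4): jet reduction at an immersive integral base point

The registered stub (skeleton v2, `Cruxes/BinomialCandidate/Lines/registered.lean`): an integral
solution `p ∈ ℂ⟦t⟧^{m-1}` of `Γ(p) = T`, `T_i = t^{N a_i} + t^{N b_i}` (`Γ` quadratic, exponents
`≥ 1`), whose base point `y₀ = p(0)` is IMMERSIVE (the `m-1` Jacobian columns `(∂_j Γ_i(y₀))_i`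
are linearly independent) yields an output `i₀`, a polynomial `ψ` in the other `m-1` output
variables without constant term, and a precision `G` beyond every degree-`≤ 2` exponent sum
with `ψ(T) ≡ T_{i₀} (mod t^G)`, such that the vanishing of all coefficients of `ψ` of degree
`≤ 2` is absurd.

Proof (the formal-implicit-function argument made finite; parts 1–3 carry the estimates, the
Picard iteration and the source coordinates):
* `exists_minor_isUnit`: `m-1` independent columns in `ℂ^m` ⇒ deleting some row `i₀` leaves an
  invertible minor `J'` (a left-kernel vector `l ≠ 0` of the `m × (m-1)` Jacobian, `i₀` with
  `l_{i₀} ≠ 0`; wave-1 lemma `AffinePeeling.exists_ne_zero_leftKernel`);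
* part 3 (`jetReduction_coordinatesLaurent`) with `M = J'⁻¹`: `q̃ = T' - B(q̃)`,
  `T_{i₀} = ℓ(q̃) + B₀(q̃)`, and `ℓ = 0 ∧ B₀ ≡ 0 ⇒ T_{i₀} = 0`;
* part 2 (`jetReduction_iterateLaurent`) with `n = 2N Σ_i (a_i + b_i) + 1`: a polynomial `ψₖ`
  in `m-1` variables, no constant term, `ψₖ(T') ≡ T_{i₀} (mod t^{n+2})`, whose vanishing 2-jet
  forces `ℓ = 0 ∧ B₀ ≡ 0`, hence `T_{i₀} = 0` — impossible, the coefficient of `t^{N a_{i₀}}` in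
  `T_{i₀}` being `1` or `2` (`AffinePeeling.coeff_binomial`);
* `ψ := rename (Fin.succAbove i₀) ψₖ`, `G := n + 2`.
-/

-- layout Summits/ValiantsHypothesis/ValiantsHypothesis forces the duplicated namespace component
set_option linter.dupNamespace false

namespace Summit.ValiantsHypothesis.ValiantsHypothesis.Theorems.BinomialCandidateStubs

open scoped BigOperators
open MvPolynomial

namespace JetReduction

/-! ## The invertible minor at an immersive point -/

/-- At an immersive point (`k` linearly independent Jacobian columns in `K^{k+1}`), deleting a
suitable row `i₀` leaves an invertible `k × k` minor. -/
theorem exists_minor_isUnit {K : Type*} [Field K] {k : ℕ} (J : Matrix (Fin (k + 1)) (Fin k) K)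
    (hJ : LinearIndependent K (fun j => fun i => J i j)) :
    ∃ i₀ : Fin (k + 1), IsUnit (Matrix.of fun i' j => J (i₀.succAbove i') j) := by
  obtain ⟨l, hl0, hl⟩ := AffinePeeling.exists_ne_zero_leftKernel (Nat.lt_succ_self k) J
  obtain ⟨i₀, hi₀⟩ := Function.ne_iff.mp hl0
  refine ⟨i₀, ?_⟩
  rw [← Matrix.linearIndependent_cols_iff_isUnit]
  rw [Fintype.linearIndependent_iff] at hJ ⊢
  intro g hg
  have hrow : ∀ i', ∑ j, g j * J (i₀.succAbove i') j = 0 := fun i' => by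
    simpa [Matrix.col, Finset.sum_apply] using congr_fun hg i'
  have hall : ∀ i, ∑ j, g j * J i j = 0 := by
    intro i
    rcases eq_or_ne i i₀ with rfl | hne
    · have hker : ∀ j, l i * J i j = -∑ i', l (i.succAbove i') * J (i.succAbove i') j :=
        fun j => by
          have := hl j
          rw [Fin.sum_univ_succAbove _ i] at this
          linear_combination this
      have key : l i * ∑ j, g j * J i j = 0 := by
        calc l i * ∑ j, g j * J i j = ∑ j, g j * (l i * J i j) := by
              rw [Finset.mul_sum]; exact Finset.sum_congr rfl fun j _ => by ring
          _ = -∑ i', l (i.succAbove i') * ∑ j, g j * J (i.succAbove i') j := by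
              simp_rw [hker, mul_neg, Finset.sum_neg_distrib, Finset.mul_sum]
              rw [Finset.sum_comm]
              exact congrArg Neg.neg (Finset.sum_congr rfl fun i' _ =>
                Finset.sum_congr rfl fun j _ => by ring)
          _ = 0 := by simp [hrow]
      exact (mul_eq_zero.mp key).resolve_left hi₀
    · obtain ⟨i', rfl⟩ := Fin.exists_succAbove_eq hne
      exact hrow i'
  refine hJ g ?_
  funext i
  simpa [Finset.sum_apply] using hall i

/-! ## The stub for `m = k + 1` -/

/-- The stub `stub_jetReduction` for `m = k + 1` outputs and `k` source variables. -/
theorem jetReduction_main (k : ℕ) (a b : Fin (k + 1) → ℕ)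
    (Γ : Fin (k + 1) → MvPolynomial (Fin k) ℂ) (N : ℕ) (p : Fin k → LaurentSeries ℂ)
    (hΓ : ∀ i, (Γ i).totalDegree ≤ 2) (hN : 0 < N) (hp : ∀ j, 0 ≤ (p j).order)
    (hLI : LinearIndependent ℂ (fun j : Fin k => fun i : Fin (k + 1) =>
      MvPolynomial.eval (fun l => (p l).coeff 0) (MvPolynomial.pderiv j (Γ i))))
    (hab : ∀ i, 1 ≤ a i ∧ 1 ≤ b i)
    (hsol : ∀ i, MvPolynomial.aeval p (Γ i) =
      HahnSeries.single ((N * a i : ℕ) : ℤ) (1 : ℂ) + HahnSeries.single ((N * b i : ℕ) : ℤ) (1 : ℂ)) :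
    ∃ (i₀ : Fin (k + 1)) (ψ : MvPolynomial (Fin (k + 1)) ℂ) (G : ℤ),
      (∀ d ∈ ψ.support, d i₀ = 0) ∧ MvPolynomial.constantCoeff ψ = 0 ∧
      (∀ i, 2 * ((N * a i : ℕ) : ℤ) < G ∧ 2 * ((N * b i : ℕ) : ℤ) < G) ∧
      (∀ g < G, (MvPolynomial.aeval (fun i : Fin (k + 1) =>
          (HahnSeries.single ((N * a i : ℕ) : ℤ) (1 : ℂ) +
          HahnSeries.single ((N * b i : ℕ) : ℤ) (1 : ℂ) : LaurentSeries ℂ)) ψ).coeff g =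
        (HahnSeries.single ((N * a i₀ : ℕ) : ℤ) (1 : ℂ) +
          HahnSeries.single ((N * b i₀ : ℕ) : ℤ) (1 : ℂ) : LaurentSeries ℂ).coeff g) ∧
      ((∀ d : Fin (k + 1) →₀ ℕ, (d.sum fun _ e => e) ≤ 2 → MvPolynomial.coeff d ψ = 0) → False) := by
  -- the target binomials, the base point, the Jacobian and the distinguished output
  set T : Fin (k + 1) → LaurentSeries ℂ := fun i =>
    HahnSeries.single ((N * a i : ℕ) : ℤ) (1 : ℂ) + HahnSeries.single ((N * b i : ℕ) : ℤ) (1 : ℂ)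
    with hTdef
  set y₀ : Fin k → ℂ := fun l => (p l).coeff 0 with hy₀
  set J : Matrix (Fin (k + 1)) (Fin k) ℂ := Matrix.of fun i j => eval y₀ (pderiv j (Γ i))
  obtain ⟨i₀, hU⟩ := exists_minor_isUnit J hLI
  set J' : Matrix (Fin k) (Fin k) ℂ := Matrix.of fun i' j => J (i₀.succAbove i') j
  have hdet : IsUnit J'.det := (Matrix.isUnit_iff_isUnit_det _).mp hU
  have hexp : ∀ i, (1 : ℤ) ≤ ((N * a i : ℕ) : ℤ) ∧ (1 : ℤ) ≤ ((N * b i : ℕ) : ℤ) := fun i =>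
    ⟨by exact_mod_cast Nat.mul_pos hN (hab i).1, by exact_mod_cast Nat.mul_pos hN (hab i).2⟩
  have hpy : ∀ j, ∀ g : ℤ, g < (1 : ℕ) →
      (p j - algebraMap ℂ (LaurentSeries ℂ) (y₀ j)).coeff g = 0 := fun j g hg => by
    rw [HahnSeries.coeff_sub, AffinePeeling.algebraMap_laurentSeries_apply]
    rcases lt_or_eq_of_le (show g ≤ 0 by push_cast at hg; omega) with hlt | rfl
    · rw [HahnSeries.coeff_single_of_ne hlt.ne, sub_zero]
      exact HahnSeries.coeff_eq_zero_of_lt_order (lt_of_lt_of_le hlt (hp j))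
    · simp [hy₀]
  have hT : ∀ i, ∀ g : ℤ, g < (1 : ℕ) → (T i).coeff g = 0 := fun i g hg => by
    have := hexp i
    rw [hTdef]
    simp only
    rw [HahnSeries.coeff_add, HahnSeries.coeff_single_of_ne (by push_cast at hg; omega),
      HahnSeries.coeff_single_of_ne (by push_cast at hg; omega), add_zero]
  -- part 3: source coordinates
  obtain ⟨B, B₀, ℓ, q, hB, hB₀, hq, hfix, hT₀, hfin⟩ := jetReduction_coordinatesLaurent k Γ p y₀ T
    i₀ J'⁻¹ hΓ hpy hT hsol (Matrix.mul_nonsing_inv J' hdet) (Matrix.nonsing_inv_mul J' hdet)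
  -- the precision
  set E : ℕ := ∑ i, (a i + b i)
  have hEi : ∀ i, N * a i ≤ N * E ∧ N * b i ≤ N * E := fun i => by
    have : a i + b i ≤ E := Finset.single_le_sum (f := fun i => a i + b i)
      (fun i _ => Nat.zero_le _) (Finset.mem_univ i)
    exact ⟨Nat.mul_le_mul_left N (by omega), Nat.mul_le_mul_left N (by omega)⟩
  set n : ℕ := 2 * (N * E) + 1 with hn
  -- part 2: the iteration
  obtain ⟨ψk, h1, h2, h3⟩ := jetReduction_iterateLaurent k B ℓ B₀ q (fun i' => T (i₀.succAbove i'))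
    (T i₀) n hB hB₀ hq (fun i' => hT _) hfix hT₀ (by omega)
  have hinj : Function.Injective (Fin.succAbove i₀) := Fin.succAbove_right_injective
  refine ⟨i₀, rename (Fin.succAbove i₀) ψk, ((n + 2 : ℕ) : ℤ), ?_, ?_, ?_, ?_, ?_⟩
  · -- ψ avoids the variable i₀
    intro d hd
    rw [support_rename_of_injective hinj, Finset.mem_image] at hd
    obtain ⟨d', -, rfl⟩ := hd
    exact Finsupp.mapDomain_notin_range _ _ fun ⟨j, hj⟩ => Fin.succAbove_ne i₀ j hj
  · -- no constant term
    rw [constantCoeff_rename, constantCoeff_eq]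
    exact h1 0 (by simp)
  · -- the precision exceeds every degree ≤ 2 exponent sum
    intro i
    obtain ⟨ha, hb⟩ := hEi i
    exact ⟨by exact_mod_cast (by omega : 2 * (N * a i) < n + 2),
      by exact_mod_cast (by omega : 2 * (N * b i) < n + 2)⟩
  · -- the congruence
    intro g hg
    rw [aeval_rename]
    have := h2 g hg
    rw [HahnSeries.coeff_sub, sub_eq_zero] at this
    exact this.symm
  · -- the finisher
    intro H
    have hψ3 : ∀ d : Fin k →₀ ℕ, d.degree < 3 → coeff d ψk = 0 := fun d hd => by
      rw [← coeff_rename_mapDomain (Fin.succAbove i₀) hinj ψk d]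
      apply H
      rw [Finsupp.sum_mapDomain_index_inj hinj]
      have : d.degree = d.sum fun _ e => e := by rw [Finsupp.degree_apply, Finsupp.sum]
      omega
    obtain ⟨hℓ, hB₀3⟩ := h3 hψ3
    have hT0 : T i₀ = 0 := hfin hℓ hB₀3
    have hc := AffinePeeling.coeff_binomial hN (a i₀) (b i₀) (a i₀)
    change (T i₀).coeff _ = _ at hc
    rw [hT0] at hc
    simp only [HahnSeries.coeff_zero, if_true] at hc
    split_ifs at hc <;> norm_num at hc

end JetReduction

open JetReduction in
/-- **Registered stub `stub_jetReduction`** (line `registered`, crux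
`BinomialElusive.BinomialCandidate`): jet reduction at an immersive integral base point — from an
integral solution `p` of `Γ(p) = (t^{N a_i} + t^{N b_i})_i` whose Jacobian columns at `p(0)` are
linearly independent, an output `i₀`, a polynomial `ψ` in the other outputs without constant term
and a precision `G` beyond every degree-`≤ 2` exponent sum with `ψ(T) ≡ T_{i₀} (mod t^G)`, such
that the vanishing of all coefficients of `ψ` of degree `≤ 2` is absurd. -/
theorem stub_jetReduction :
    ∀ m ≥ 1, ∀ (a b : Fin m → ℕ) (Γ : Fin m → MvPolynomial (Fin (m - 1)) ℂ) (N : ℕ)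
      (p : Fin (m - 1) → LaurentSeries ℂ), (∀ i, (Γ i).totalDegree ≤ 2) → 0 < N →
      (∀ j, 0 ≤ (p j).order) →
      LinearIndependent ℂ (fun j : Fin (m - 1) => fun i : Fin m =>
        MvPolynomial.eval (fun l => (p l).coeff 0) (MvPolynomial.pderiv j (Γ i))) →
      (∀ i, 1 ≤ a i ∧ 1 ≤ b i) →
      (∀ i, MvPolynomial.aeval p (Γ i) =
        HahnSeries.single ((N * a i : ℕ) : ℤ) (1 : ℂ) + HahnSeries.single ((N * b i : ℕ) : ℤ) (1 : ℂ)) →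
      ∃ (i₀ : Fin m) (ψ : MvPolynomial (Fin m) ℂ) (G : ℤ),
        (∀ d ∈ ψ.support, d i₀ = 0) ∧ MvPolynomial.constantCoeff ψ = 0 ∧
        (∀ i, 2 * ((N * a i : ℕ) : ℤ) < G ∧ 2 * ((N * b i : ℕ) : ℤ) < G) ∧
        (∀ g < G, (MvPolynomial.aeval (fun i : Fin m => (HahnSeries.single ((N * a i : ℕ) : ℤ) (1 : ℂ) +
            HahnSeries.single ((N * b i : ℕ) : ℤ) (1 : ℂ) : LaurentSeries ℂ)) ψ).coeff g =
          (HahnSeries.single ((N * a i₀ : ℕ) : ℤ) (1 : ℂ) +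
            HahnSeries.single ((N * b i₀ : ℕ) : ℤ) (1 : ℂ) : LaurentSeries ℂ).coeff g) ∧
        ((∀ d : Fin m →₀ ℕ, (d.sum fun _ e => e) ≤ 2 → MvPolynomial.coeff d ψ = 0) → False) := by
  intro m hm
  obtain ⟨k, rfl⟩ : ∃ k, m = k + 1 := ⟨m - 1, by omega⟩
  exact jetReduction_main k

end Summit.ValiantsHypothesis.ValiantsHypothesis.Theorems.BinomialCandidateStubs
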